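import Mathlib
import HarnessLib
import Summits.AtomisticToContinuum.FouriersLaw.Theses.JunctionLocality
import Summits.AtomisticToContinuum.FouriersLaw.Theorems.VanishingNoiseTransferVanishingNoiseBoundFlipBondCurrents

/-!
# `ConductanceLowerBound` from a LOCAL OHM LOWER BOUND (crux stmt-AtomisticToContinuum-11749, line
`kick-dipole-no-collapse`, lead c1 — a checked reduction for planners)

The crux `JunctionLocality.ConductanceLowerBound` asks for an `N`-uniform lower bound `liminf_N D_N > 0` on the
response coefficients of the pinned anharmonic chain.  This file records the EXACT sum rule behind every
"Ohm-slope" argument and the resulting reduction of the crux to an `(N, x)`-uniform but LOCAL inequality: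

* **Sum rule** (energy balance of a weak steady state, BLR 2000 §5.2): with `J̃ = γ(T_L − ⟨p_0²⟩_μ)` the common
  value of all bond currents (`VanishingNoiseBound.integral_bondCurrent_eq`) and `⟨p_0²⟩ + ⟨p_{N−1}²⟩ = T_L + T_R`
  (`integral_sq_momentum_ends`), the bias splits as
  `T_L − T_R = 2J̃/γ + Σ_{x=0}^{N−2} (⟨p_x²⟩_μ − ⟨p_{x+1}²⟩_μ)` — two contact jumps plus the interior
  kinetic-temperature drops (a telescoping identity, no moment hypothesis).
* **Reduction** `conductanceLowerBound_of_localOhmLowerBound`: if for all parameters `> 0` and `T > 0` there is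
  `c > 0` such that for every `N ≥ 2`, all sufficiently small biases `δ > 0` (`δ < δ₀(N)`) and every weak steady
  state `μ` at `(T + δ/2, T − δ/2)`, EVERY bond satisfies the local Ohm LOWER bound
  `c · (⟨p_x²⟩_μ − ⟨p_{x+1}²⟩_μ) ≤ ⟨j_x⟩_μ` ("no kinetic-temperature drop without a proportional current"; vacuous
  where the drop is `≤ 0`), then summing over the `N − 1` bonds gives `(N−1)J̃ ≥ c(δ − 2J̃/γ)`, i.e.
  `totalCurrent(μ)/δ = (N−1)J̃/δ ≥ c(N−1)/((N−1) + 2c/γ) ≥ c/(1 + 2c/γ)` for every `N ≥ 2`, and the crux follows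
  with `c' = c/(1 + 2c/γ)`, `N₁ = 2` (limit `δ → 0⁺` inside the crux's two-sided response limit).

The hypothesis is the POSITIVITY DUAL of the crux `LocalOhm` of route `LocalOhmBV` (stmt-AtomisticToContinuum-12009:
`|d|/(N−1) ≤ C ·` windowed variation of the response profile — no current without a gradient); the two together
are a two-sided local Ohm law.  It is stated at FINITE bias with an `N`-dependent `δ₀` (no response-profile
limits are needed, so the open support item `FiniteResponseProfile` is not a dependency).  Not a proof of the
crux: the local lower bound carries the whole `N`-uniform content; this file makes the edge kernel-checked.
-/

noncomputable section

open MeasureTheory Filter Topology Set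
open scoped BigOperators

namespace Summit.AtomisticToContinuum.FouriersLaw.Cruxes.ConductanceLowerBound.KickDipoleNoCollapse

open Literature.MathematicalPhysics.KineticTheory.HeatConduction
open Summit.AtomisticToContinuum.FouriersLaw.Theorems.VanishingNoiseBound
  (integral_bondCurrent_eq totalCurrent_eq_left integral_sq_momentum_ends)

/-- **Telescoping of the interior kinetic-temperature drops.**  For any real sequence `a` indexed by `Fin N`
(`N = M + 1`): `Σ_{b < M} (a_b − a_{b+1}) = a_0 − a_M`. [folklore] -/
theorem sum_fin_sub_succ {M : ℕ} (a : Fin (M + 1) → ℝ) :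
    ∑ b : Fin M, (a b.castSucc - a b.succ) = a 0 - a (Fin.last M) := by
  rw [Finset.sum_sub_distrib]
  have h1 := Fin.sum_univ_castSucc a
  have h2 := Fin.sum_univ_succ a
  linarith

/-- **The crux from a local Ohm LOWER bound (finite bias, `N`-dependent `δ₀`).**  If for all parameters `> 0` and
`T > 0` there is `c > 0` such that for every `N ≥ 2` there is `δ₀ > 0` with: for all `0 < δ < δ₀`, every weak
steady state `μ` of `pinnedChain ω₂ lam β γ` at `(T + δ/2, T − δ/2)` and every bond `(x, x+1)`,
`c · (∫ p_x² dμ − ∫ p_{x+1}² dμ) ≤ ∫ j_x dμ`, then `ConductanceLowerBound` holds (with `c' = c/(1 + 2c/γ)`,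
`N₁ = 2`).  Proof: all bond currents equal `J̃ = γ(T_L − ∫p_0²)` and `∫p_0² + ∫p_{N−1}² = T_L + T_R`
(energy balance, `VanishingNoiseBound.integral_bondCurrent_eq`, `integral_sq_momentum_ends`), so the drops
telescope to `δ − 2J̃/γ`; summing the local bound over the `N − 1` bonds, `(N−1)J̃ ≥ c(δ − 2J̃/γ)`, whence
`totalCurrent(μ)/δ = (N−1)J̃/δ ≥ c(N−1)/((N−1)+2c/γ) ≥ c/(1+2c/γ)` for all small `δ > 0`, and the two-sided
response limit `D_N` inherits the bound along `δ → 0⁺`. [cite: BonettoLebowitzReyBellet2000, §5.2 eqs. (25)–(27)] -/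
theorem conductanceLowerBound_of_localOhmLowerBound :
    (∀ ω₂ lam β γ : ℝ, 0 < ω₂ → 0 < lam → 0 < β → 0 < γ → ∀ T : ℝ, 0 < T →
      ∃ c : ℝ, 0 < c ∧ ∀ N : ℕ, 2 ≤ N → ∃ δ₀ : ℝ, 0 < δ₀ ∧ ∀ δ : ℝ, 0 < δ → δ < δ₀ →
        ∀ μ : Measure (PhaseSpace N), (pinnedChain ω₂ lam β γ).IsSteadyState N (T + δ / 2) (T - δ / 2) μ →
          ∀ (i : Fin N) (hi : i.val + 1 < N),
            c * ((∫ x, x.2 i ^ 2 ∂μ) - ∫ x, x.2 ⟨i.val + 1, hi⟩ ^ 2 ∂μ) ≤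
              ∫ x, (pinnedChain ω₂ lam β γ).bondCurrent N i x ∂μ) →
    Summit.AtomisticToContinuum.FouriersLaw.Theses.JunctionLocality.ConductanceLowerBound := by
  intro hLOLB ω₂ lam β γ hω hl hβ hγ _huniq μ hμ T hT D hD
  obtain ⟨c, hc, hN⟩ := hLOLB ω₂ lam β γ hω hl hβ hγ T hT
  refine ⟨c / (1 + 2 * c / γ), by positivity, 2, fun N hN2 => ?_⟩
  obtain ⟨δ₀, hδ₀, hloc⟩ := hN N hN2
  set P := pinnedChain ω₂ lam β γ with hP
  have hN0 : 0 < N := by omega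
  -- the bound on the response quotient for every small positive bias
  have key : ∀ δ : ℝ, 0 < δ → δ < min δ₀ T →
      c / (1 + 2 * c / γ) ≤ P.totalCurrent (μ N (T + δ / 2) (T - δ / 2)) / δ := by
    intro δ hδ hδm
    have hδ₀' : δ < δ₀ := lt_of_lt_of_le hδm (min_le_left _ _)
    have hδT : δ < T := lt_of_lt_of_le hδm (min_le_right _ _)
    have hTL : 0 < T + δ / 2 := by linarith
    have hTR : 0 < T - δ / 2 := by linarith
    set ν := μ N (T + δ / 2) (T - δ / 2) with hν
    have hst : P.IsSteadyState N (T + δ / 2) (T - δ / 2) ν := hμ N _ _ hTL hTR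
    have hfl : P.IsFlipSteadyState N (T + δ / 2) (T - δ / 2) 0 ν := (P.isFlipSteadyState_zero_iff N _ _ ν).2 hst
    -- energy balance
    set a : Fin N → ℝ := fun i => ∫ x, x.2 i ^ 2 ∂ν with ha
    set Jt : ℝ := γ * ((T + δ / 2) - a ⟨0, hN0⟩) with hJt
    have hbond : ∀ (i : Fin N) (hi : i.val + 1 < N), ∫ x, P.bondCurrent N i x ∂ν = Jt := fun i hi =>
      integral_bondCurrent_eq hω hl.le hβ.le hγ hN0 hTL.le hTR.le hfl hi
    have htot : P.totalCurrent ν = ((N : ℝ) - 1) * Jt := by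
      rw [totalCurrent_eq_left hω hl.le hβ.le hγ hN0 hTL.le hTR.le hfl, hJt]; ring
    have hends : a ⟨0, hN0⟩ + a ⟨N - 1, Nat.sub_lt hN0 one_pos⟩ = (T + δ / 2) + (T - δ / 2) :=
      integral_sq_momentum_ends hω hl.le hβ.le hγ hN0 hfl
    -- telescoping of the drops over the `N - 1 = M` bonds
    obtain ⟨M, rfl⟩ : ∃ M, N = M + 1 := ⟨N - 1, by omega⟩
    have hsum : ∑ b : Fin M, (a b.castSucc - a b.succ) = a 0 - a (Fin.last M) := sum_fin_sub_succ a
    have hlast : a (Fin.last M) = a ⟨M + 1 - 1, Nat.sub_lt hN0 one_pos⟩ := by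
      congr 1
    have h0 : a 0 = a ⟨0, hN0⟩ := rfl
    -- sum of the local bounds
    have hle : ∀ b : Fin M, c * (a b.castSucc - a b.succ) ≤ Jt := by
      intro b
      have hi : (b.castSucc : Fin (M + 1)).val + 1 < M + 1 := by simp [b.isLt]
      have h := hloc δ hδ hδ₀' ν hst b.castSucc hi
      have e : (⟨(b.castSucc : Fin (M + 1)).val + 1, hi⟩ : Fin (M + 1)) = b.succ := by
        ext; simp [Fin.val_succ]
      rw [e, hbond _ hi] at h
      exact h
    have hsumle : c * (a 0 - a (Fin.last M)) ≤ (M : ℝ) * Jt := by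
      rw [← hsum, Finset.mul_sum]
      calc ∑ b : Fin M, c * (a b.castSucc - a b.succ) ≤ ∑ _b : Fin M, Jt := Finset.sum_le_sum fun b _ => hle b
        _ = (M : ℝ) * Jt := by simp
    -- the drops add up to `δ - 2 Jt/γ`
    have hdrops : a 0 - a (Fin.last M) = δ - 2 * Jt / γ := by
      rw [h0, hlast]
      have e1 : a ⟨0, hN0⟩ = (T + δ / 2) - Jt / γ := by rw [hJt]; field_simp; ring
      have e2 : a ⟨M + 1 - 1, Nat.sub_lt hN0 one_pos⟩ = (T - δ / 2) + Jt / γ := by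
        rw [e1] at hends; linarith
      rw [e1, e2]; ring
    rw [hdrops] at hsumle
    -- `(M + 2c/γ) Jt ≥ c δ`
    have hM1 : (1 : ℝ) ≤ M := by exact_mod_cast (by omega : 1 ≤ M)
    have hJ : c * δ ≤ ((M : ℝ) + 2 * c / γ) * Jt := by
      have : c * (δ - 2 * Jt / γ) = c * δ - (2 * c / γ) * Jt := by ring
      rw [this] at hsumle; nlinarith
    have hden : 0 < (M : ℝ) + 2 * c / γ := by positivity
    have hden1 : 0 < 1 + 2 * c / γ := by positivity
    -- totalCurrent/δ = M Jt/δ ≥ c M/(M + 2c/γ) ≥ c/(1 + 2c/γ)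
    have hcast : ((M + 1 : ℕ) : ℝ) - 1 = M := by push_cast; ring
    rw [htot, hcast, le_div_iff₀ hδ]
    have h1 : c * δ * M ≤ ((M : ℝ) + 2 * c / γ) * Jt * M := by nlinarith
    have h2 : c / (1 + 2 * c / γ) * δ * ((M : ℝ) + 2 * c / γ) ≤ c * δ * M := by
      rw [div_mul_eq_mul_div, div_mul_eq_mul_div, div_le_iff₀ hden1]
      have : c * δ * ((M : ℝ) + 2 * c / γ) ≤ c * δ * M * (1 + 2 * c / γ) := by
        have hx : 0 ≤ c * δ * (2 * c / γ) := by positivity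
        have hxM : c * δ * (2 * c / γ) * 1 ≤ c * δ * (2 * c / γ) * M := mul_le_mul_of_nonneg_left hM1 hx
        nlinarith [hxM]
      linarith
    have h3 : c / (1 + 2 * c / γ) * δ * ((M : ℝ) + 2 * c / γ) ≤ (M : ℝ) * Jt * ((M : ℝ) + 2 * c / γ) := by
      nlinarith
    exact le_of_mul_le_mul_right h3 hden
  -- pass to the limit `δ → 0⁺` inside the two-sided response limit
  have hD' : Tendsto (fun δ : ℝ => P.totalCurrent (μ N (T + δ / 2) (T - δ / 2)) / δ) (𝓝[>] 0) (𝓝 (D N)) :=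
    (hD N).mono_left (nhdsWithin_mono _ fun x hx => ne_of_gt hx)
  refine ge_of_tendsto hD' ?_
  have hmem : Ioo (0 : ℝ) (min δ₀ T) ∈ 𝓝[>] (0 : ℝ) := Ioo_mem_nhdsGT (lt_min hδ₀ hT)
  filter_upwards [hmem] with δ hδ
  exact key δ hδ.1 hδ.2

end Summit.AtomisticToContinuum.FouriersLaw.Cruxes.ConductanceLowerBound.KickDipoleNoCollapse

end
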